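import Summits.BirchSwinnertonDyer.BirchSwinnertonDyer.Theorems.SignedLowerHalvesSmallImageLowerHalfBothSignsRttCharRoadLocalShape
import Literature.NumberTheory.GaloisRepresentations.WeilGroupDensityProofs
import HarnessLib

/-!
# Route `SignedLowerHalves`, crux L `SmallImageLowerHalfBothSigns` (item stmt-BirchSwinnertonDyer-23599), line `rtt_w3` v8 —
# row J-glue, step «character identification»: `θ|_{Γ_{K_v}} = f₀ ∘ χW` on the WHOLE decomposition group from the Weil group

LEAD `cruxlead-stmt-BirchSwinnertonDyer-23599` g5; helper `--supports stmt-BirchSwinnertonDyer-23599`; THEOREMS ONLY, no `sorry`; closes nothing;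
BSD / crux L / J are not proved by this.

In the J-glue (spec `Cruxes/…/Lines/rtt_w3_JGLUE_spec.lean`) the character side (J-char p761160: `θ(res w)₀₀ = e⁻¹(ψ v)^{deg w}·f₀(art w)` on
`W_{K_v}`) and the curve side (J-curve: `χW(w) = art(w)·(−p)^{deg w}` on `W_{K_v}`) give `θ(res w)₀₀ = f₀(χW w)` on the image of the Weil group
once `e⁻¹(ψ v) = −p` (prep lemma `symm_psi_eq_neg_natCast`); the transport `j = (f₀ mod 𝒪) ∘ α` needs it on ALL of `Γ_{K_v}`. This file proves the
two steps: `theta_res_weil_eq_of_shapes` (the algebra on `W_{K_v}`) and ★ `theta_res_eq_of_weil` (extension to `Γ_{K_v}` by continuity and the density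
of the Weil group, `WeilGroup.denseRange_toAbsGalois_holds`).

References: [Corvallis1979] (1.4.1) (density of `W_F`); [SerreAbelianLadic1968] Ch. III §2.3.
-/

set_option autoImplicit false
-- D-0017: single-problem summit, the namespace repeats the problem name by design.
set_option linter.dupNamespace false
noncomputable section

open scoped NumberField MatrixGroups Topology
open NumberField IsDedekindDomain Polynomial Field
  Literature.NumberTheory.GaloisRepresentations Literature.NumberTheory.EllipticCurves

namespace Summit.BirchSwinnertonDyer.BirchSwinnertonDyer.Theorems.SmallImageRttCharRoad

variable {K : Type} [Field K] [NumberField K] {p : ℕ} [Fact p.Prime] {S : Set (PadicAlgCl p)}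

/-- **The two local shapes agree on the Weil group.** If `θ(res w)₀₀ = c^{deg w}·f₀(art w)` (character side) and `χW(w) = art(w)·c'^{deg w}`
(curve side) with `f₀(c') = c`, then `θ(res w)₀₀ = f₀(χW w)` for every `w ∈ W_{K_v}`. [cite: SerreAbelianLadic1968, Ch. III §2.3] -/
theorem theta_res_weil_eq_of_shapes {v : HeightOneSpectrum (𝓞 K)} (θ : FramedGaloisRep K (padicCoeffIntegers S) 1)
    (f₀ : v.adicCompletion K →+* PadicAlgCl p) (art : WeilGroup (v.adicCompletion K) →* (v.adicCompletion K)ˣ)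
    (χW : absoluteGaloisGroup (v.adicCompletion K) →* (v.adicCompletionIntegers K)ˣ)
    {c : PadicAlgCl p} {c' : v.adicCompletion K} (hc : f₀ c' = c)
    (hθ : ∀ w : WeilGroup (v.adicCompletion K),
      ((((θ (resGalOfEmb (closureEmb (K := K) (v.adicCompletion K)) (WeilGroup.toAbsGalois (v.adicCompletion K) w)) :
          GL (Fin 1) (padicCoeffIntegers S)) : Matrix (Fin 1) (Fin 1) (padicCoeffIntegers S)) 0 0 : padicCoeffIntegers S) :
          PadicAlgCl p) = c ^ (WeilGroup.deg w) * f₀ ((art w : (v.adicCompletion K)ˣ) : v.adicCompletion K))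
    (hχ : ∀ w : WeilGroup (v.adicCompletion K),
      (((χW (WeilGroup.toAbsGalois (v.adicCompletion K) w)) : v.adicCompletionIntegers K) : v.adicCompletion K) =
        ((art w : (v.adicCompletion K)ˣ) : v.adicCompletion K) * c' ^ (WeilGroup.deg w))
    (w : WeilGroup (v.adicCompletion K)) :
    ((((θ (resGalOfEmb (closureEmb (K := K) (v.adicCompletion K)) (WeilGroup.toAbsGalois (v.adicCompletion K) w)) :
        GL (Fin 1) (padicCoeffIntegers S)) : Matrix (Fin 1) (Fin 1) (padicCoeffIntegers S)) 0 0 : padicCoeffIntegers S) :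
        PadicAlgCl p) =
      f₀ (((χW (WeilGroup.toAbsGalois (v.adicCompletion K) w)) : v.adicCompletionIntegers K) : v.adicCompletion K) := by
  rw [hθ w, hχ w, map_mul, map_zpow₀, hc, mul_comm]

/-- ★ **Character identification on the whole decomposition group.** If `θ(res δ)₀₀ = f₀(χW δ)` for `δ` in the image of the Weil group
`W_{K_v} → Γ_{K_v}`, with `f₀` and `χW` continuous, then it holds for EVERY `δ ∈ Γ_{K_v}`: both sides are continuous `Γ_{K_v} → ℚ̄_p` and the Weil
group is dense (`WeilGroup.denseRange_toAbsGalois_holds`). [cite: Corvallis1979, (1.4.1)] -/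
theorem theta_res_eq_of_weil {v : HeightOneSpectrum (𝓞 K)} (θ : FramedGaloisRep K (padicCoeffIntegers S) 1)
    (f₀ : v.adicCompletion K →+* PadicAlgCl p) (hf₀ : Continuous f₀)
    (χW : absoluteGaloisGroup (v.adicCompletion K) →* (v.adicCompletionIntegers K)ˣ) (hχW : Continuous χW)
    (h : ∀ w : WeilGroup (v.adicCompletion K),
      ((((θ (resGalOfEmb (closureEmb (K := K) (v.adicCompletion K)) (WeilGroup.toAbsGalois (v.adicCompletion K) w)) :
          GL (Fin 1) (padicCoeffIntegers S)) : Matrix (Fin 1) (Fin 1) (padicCoeffIntegers S)) 0 0 : padicCoeffIntegers S) :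
          PadicAlgCl p) =
        f₀ (((χW (WeilGroup.toAbsGalois (v.adicCompletion K) w)) : v.adicCompletionIntegers K) : v.adicCompletion K))
    (δ : absoluteGaloisGroup (v.adicCompletion K)) :
    ((((θ (resGalOfEmb (closureEmb (K := K) (v.adicCompletion K)) δ) : GL (Fin 1) (padicCoeffIntegers S)) :
        Matrix (Fin 1) (Fin 1) (padicCoeffIntegers S)) 0 0 : padicCoeffIntegers S) : PadicAlgCl p) =
      f₀ (((χW δ) : v.adicCompletionIntegers K) : v.adicCompletion K) := by
  -- the two continuous functions `Γ_{K_v} → ℚ̄_p`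
  set F₁ : absoluteGaloisGroup (v.adicCompletion K) → PadicAlgCl p := fun δ =>
    ((((θ (resGalOfEmb (closureEmb (K := K) (v.adicCompletion K)) δ) : GL (Fin 1) (padicCoeffIntegers S)) :
        Matrix (Fin 1) (Fin 1) (padicCoeffIntegers S)) 0 0 : padicCoeffIntegers S) : PadicAlgCl p) with hF₁
  set F₂ : absoluteGaloisGroup (v.adicCompletion K) → PadicAlgCl p := fun δ =>
    f₀ (((χW δ) : v.adicCompletionIntegers K) : v.adicCompletion K) with hF₂
  have h₁ : Continuous F₁ := by
    refine continuous_subtype_val.comp ?_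
    exact (Units.continuous_val.comp ((map_continuous θ).comp
      (map_continuous (resGalOfEmb (closureEmb (K := K) (v.adicCompletion K)))))).matrix_elem 0 0
  have h₂ : Continuous F₂ :=
    hf₀.comp (continuous_subtype_val.comp (Units.continuous_val.comp hχW))
  have heq : F₁ = F₂ :=
    Continuous.ext_on (WeilGroup.denseRange_toAbsGalois_holds (v.adicCompletion K)) h₁ h₂
      (by rintro _ ⟨w, rfl⟩; exact h w)
  exact congrFun heq δ

end Summit.BirchSwinnertonDyer.BirchSwinnertonDyer.Theorems.SmallImageRttCharRoad

end
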